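import Mathlib
import HarnessLib
import Literature.MathematicalPhysics.QuantumFieldTheory.ConstructiveQFTWave0
import Literature.MathematicalPhysics.QuantumLattice.AbelianMagneticFlux
import Literature.Topology.FourManifolds.TorusMapDegree
import Summits.Ventures.LatticeQCDFlow.Scaling.TopologicalCollar
import Summits.Ventures.LatticeQCDFlow.Scaling.FluxSectorCollar

/-!
# LatticeQCDFlow / Scaling — sector confinement of continuous flows: topological mode collapse as a theorem (v2.6, (C2c))

HONEST FRAMING: exact (Metropolis-corrected) sampling algorithms for lattice gauge theory; figures
of merit are autocorrelation/cost numbers at stated couplings and volumes; no continuum-physics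
claim.

THEORY-2.md §3.3 (C2c).  The folklore "a normalizing flow is a continuous deformation and cannot
change topology, hence collapses onto one topological sector" has no literal meaning on the lattice
(the configuration space `U(1)^E` is connected and the charge is defined everywhere).  Its correct
lattice form is a DICHOTOMY about the DEFECT SET
`D_{μν} = {U | ∃ x, U_{μν}(x) = −1} = collar μ ν 0` (an exactly anti-aligned plaquette; a closed
null set of every Wilson measure):
* `continuousOn_topCharge_compl_collar_zero`: the flux charge `Q = topCharge x₀ μ ν`
  (`FluxSectorCollar.lean`; an integer, Lüscher's flux quantum number) is CONTINUOUS off `D_{μν}`;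
* **`topCharge_comp_eq_of_preconnected`** (sector confinement): if `Y` is a preconnected
  topological space (e.g. the Gaussian prior space `ℝ^E`, or the Haar prior space `U(1)^E`) and
  `T : Y → U(1)^E` is continuous with `T(Y) ∩ D_{μν} = ∅`, then `Q ∘ T` is CONSTANT: the flow
  represents exactly one flux sector, for EVERY prior on `Y` (`map_topCharge_ne_eq_zero`:
  `(γ.map T){Q ≠ Q(T y₀)} = 0`);
* **`sectorMass_le_of_accurate`** (the price): if such a `T` is `ε`-accurate for a finite target `m`
  on measurable sets, `|m(S) − (γ.map T)(S)| ≤ ε`, then `m{Q ≠ q} ≤ ε` for the represented sector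
  `q` — i.e. `ε ≥ inf_q m{Q ≠ q}`, the target's sector spread (for the 2-d Wilson law at large
  `βV`: `≈ 1 − (2πχ_t V)^{-1/2}`, close to `1`).
Contrapositive: every continuous flow that is better than sector-spread-accurate DOES hit the
defect set, and (C2b′) (`FluxSectorCollar.accurateTransport_lipschitz_ge_collar`) prices how much
prior mass it must place near it.  Volume- and dimension-uniform; no new definitions.

SCOPE (honest reading).  A SURJECTIVE map — in particular every bijective normalizing flow of the
compact prior `U(1)^E` onto itself — meets the (non-empty) defect set, so for such maps the
hypothesis `T(Y) ∩ D = ∅` fails and this file says nothing: the "topological obstruction" of the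
folklore is VOID for bijections, whose only constraint is the METRIC collar law (C2b′) (how much
prior mass must be mapped within `4r` of `D`).  The theorem isolates exactly what the folklore
proves: total collapse for defect-avoiding maps (e.g. non-surjective generators, truncated or
clipped flows), nothing for homeomorphisms.
-/

noncomputable section

namespace Summit.Ventures.LatticeQCDFlow.Theory2.Lattice.Flux

open MeasureTheory Metric Set Filter Topology Real
open Literature.MathematicalPhysics.QuantumFieldTheory Literature.MathematicalPhysics.QuantumLattice

variable {d L : ℕ}

/-! ## §1. The defect set -/

/-- The defect set `collar μ ν 0` is the set of configurations with an exactly anti-aligned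
`(μ,ν)`-plaquette. [folklore] -/
theorem mem_collar_zero_iff (μ ν : Fin d) (U : GaugeConfig d L Circle) :
    U ∈ collar μ ν 0 ↔ ∃ x : Site d L, plaquetteHolonomy U x μ ν = -1 := by
  simp only [collar, mem_setOf_eq, norm_le_zero_iff, add_eq_zero_iff_eq_neg]
  refine exists_congr fun x => ?_
  rw [← Circle.coe_inj, Circle.coe_neg, Circle.coe_one]

/-- Off the defect set no `(μ,ν)`-plaquette equals `−1`. [folklore] -/
theorem plaquetteHolonomy_ne_neg_one_of_not_mem_collar_zero {μ ν : Fin d}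
    {U : GaugeConfig d L Circle} (hU : U ∉ collar μ ν 0) (x : Site d L) :
    plaquetteHolonomy U x μ ν ≠ -1 := fun h =>
  hU ((mem_collar_zero_iff μ ν U).mpr ⟨x, h⟩)

/-! ## §2. The charge is continuous off the defect set; half-integers are not charges -/

/-- The field tensor `F_{μν}(x) = arg U_{μν}(x)` is continuous off the defect set. [folklore] -/
theorem continuousOn_abelianFieldTensor_compl_collar_zero (x : Site d L) (μ ν : Fin d) :
    ContinuousOn (fun U : GaugeConfig d L Circle => abelianFieldTensor U x μ ν) (collar μ ν 0)ᶜ := by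
  intro U hU
  have hc : Continuous fun V : GaugeConfig d L Circle => ((plaquetteHolonomy V x μ ν : Circle) : ℂ) :=
    continuous_subtype_val.comp (continuous_plaquetteHolonomy x μ ν)
  exact (ContinuousAt.comp (g := Complex.arg)
    (f := fun V : GaugeConfig d L Circle => ((plaquetteHolonomy V x μ ν : Circle) : ℂ))
    (Complex.continuousAt_arg (Circle.mem_slitPlane_of_ne_neg_one _
      (plaquetteHolonomy_ne_neg_one_of_not_mem_collar_zero hU x)))
    hc.continuousAt).continuousWithinAt

variable [NeZero L]

/-- No flux charge is a half-integer. [folklore] -/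
theorem topCharge_ne_int_add_half (x₀ : Site d L) (μ ν : Fin d) (U : GaugeConfig d L Circle)
    (n : ℤ) : topCharge x₀ μ ν U ≠ n + 1 / 2 := by
  obtain ⟨m, hm⟩ := exists_int_eq_topCharge x₀ μ ν U
  rw [hm]
  intro h
  have h2 : ((2 * m : ℤ) : ℝ) = ((2 * n + 1 : ℤ) : ℝ) := by push_cast; linarith
  have h3 : 2 * m = 2 * n + 1 := by exact_mod_cast h2
  omega

/-- The flux charge is continuous off the defect set. [folklore] -/
theorem continuousOn_topCharge_compl_collar_zero (x₀ : Site d L) (μ ν : Fin d) :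
    ContinuousOn (topCharge (L := L) x₀ μ ν) (collar μ ν 0)ᶜ := by
  unfold topCharge magneticFlux
  exact ContinuousOn.div_const (continuousOn_finsetSum _ fun s _ =>
    continuousOn_finsetSum _ fun t _ => continuousOn_abelianFieldTensor_compl_collar_zero _ μ ν) _

/-! ## §3. Sector confinement of continuous maps from preconnected priors -/

/-- **Sector confinement.**  A continuous map from a preconnected space into `U(1)` configurations
that avoids the defect set represents exactly one flux sector. [folklore] -/
theorem topCharge_comp_eq_of_preconnected {Y : Type*} [TopologicalSpace Y] [PreconnectedSpace Y]
    {T : Y → GaugeConfig d L Circle} (hT : Continuous T) (x₀ : Site d L) {μ ν : Fin d}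
    (hD : ∀ y, T y ∉ collar μ ν 0) (y y' : Y) :
    topCharge x₀ μ ν (T y) = topCharge x₀ μ ν (T y') := by
  have hc : Continuous fun z => topCharge x₀ μ ν (T z) :=
    (continuousOn_topCharge_compl_collar_zero x₀ μ ν).comp_continuous hT hD
  by_contra hne
  obtain ⟨n, hn⟩ := exists_int_eq_topCharge x₀ μ ν (T y)
  obtain ⟨n', hn'⟩ := exists_int_eq_topCharge x₀ μ ν (T y')
  rcases lt_or_gt_of_ne hne with hlt | hlt
  · have hnn : n < n' := by
      have : (n : ℝ) < n' := by rw [← hn, ← hn']; exact hlt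
      exact_mod_cast this
    have hmem : ((n : ℝ) + 1 / 2) ∈ Icc (topCharge x₀ μ ν (T y)) (topCharge x₀ μ ν (T y')) := by
      rw [hn, hn']
      have : (n : ℝ) + 1 ≤ n' := by exact_mod_cast hnn
      exact ⟨by linarith, by linarith⟩
    obtain ⟨z, hz⟩ := intermediate_value_univ y y' hc hmem
    exact topCharge_ne_int_add_half x₀ μ ν (T z) n hz
  · have hnn : n' < n := by
      have : (n' : ℝ) < n := by rw [← hn, ← hn']; exact hlt
      exact_mod_cast this
    have hmem : ((n' : ℝ) + 1 / 2) ∈ Icc (topCharge x₀ μ ν (T y')) (topCharge x₀ μ ν (T y)) := by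
      rw [hn, hn']
      have : (n' : ℝ) + 1 ≤ n := by exact_mod_cast hnn
      exact ⟨by linarith, by linarith⟩
    obtain ⟨z, hz⟩ := intermediate_value_univ y' y hc hmem
    exact topCharge_ne_int_add_half x₀ μ ν (T z) n' hz

/-- **Topological mode collapse.**  The push-forward of ANY measure on a preconnected prior space
under a continuous defect-avoiding map gives mass `0` to every sector but one. [folklore] -/
theorem map_topCharge_ne_eq_zero {Y : Type*} [TopologicalSpace Y] [PreconnectedSpace Y]
    [MeasurableSpace Y] [OpensMeasurableSpace Y] (γ : Measure Y)
    {T : Y → GaugeConfig d L Circle} (hT : Continuous T) (x₀ : Site d L) {μ ν : Fin d}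
    (hD : ∀ y, T y ∉ collar μ ν 0) (y₀ : Y) :
    γ.map T {U | topCharge x₀ μ ν U ≠ topCharge x₀ μ ν (T y₀)} = 0 := by
  have hS : MeasurableSet {U : GaugeConfig d L Circle | topCharge x₀ μ ν U ≠ topCharge x₀ μ ν (T y₀)} :=
    (measurable_topCharge x₀ μ ν (measurableSet_singleton _)).compl
  rw [Measure.map_apply hT.measurable hS]
  have : T ⁻¹' {U | topCharge x₀ μ ν U ≠ topCharge x₀ μ ν (T y₀)} = ∅ := by
    ext y
    simp only [mem_preimage, mem_setOf_eq, mem_empty_iff_false, iff_false, not_not]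
    exact topCharge_comp_eq_of_preconnected hT x₀ hD y y₀
  rw [this, measure_empty]

/-- **The price of avoiding the defect set.**  If a continuous defect-avoiding map from a
preconnected prior is `ε`-accurate for a finite target `m` on measurable sets, then the target
mass outside the represented sector is at most `ε`; contrapositively, a flow more accurate than
the target's sector spread `inf_q m{Q ≠ q}` must hit the defect set. [folklore] -/
theorem sectorMass_le_of_accurate {Y : Type*} [TopologicalSpace Y] [PreconnectedSpace Y]
    [MeasurableSpace Y] [OpensMeasurableSpace Y] {γ : Measure Y}
    {T : Y → GaugeConfig d L Circle} (hT : Continuous T) (x₀ : Site d L) {μ ν : Fin d}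
    (hD : ∀ y, T y ∉ collar μ ν 0) {m : Measure (GaugeConfig d L Circle)} {ε : ℝ}
    (hacc : ∀ S : Set (GaugeConfig d L Circle), MeasurableSet S →
      |m.real S - (γ.map T).real S| ≤ ε) (y₀ : Y) :
    m.real {U | topCharge x₀ μ ν U ≠ topCharge x₀ μ ν (T y₀)} ≤ ε := by
  have hS : MeasurableSet {U : GaugeConfig d L Circle | topCharge x₀ μ ν U ≠ topCharge x₀ μ ν (T y₀)} :=
    (measurable_topCharge x₀ μ ν (measurableSet_singleton _)).compl
  have h := hacc _ hS
  rw [measureReal_def ((γ.map T)), map_topCharge_ne_eq_zero γ hT x₀ hD y₀, ENNReal.toReal_zero,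
    sub_zero] at h
  exact le_of_abs_le h

/-- Hence there IS a sector `q ∈ ℤ` carrying all of the flow and all but `ε` of the target.
[folklore] -/
theorem exists_sector_of_accurate {Y : Type*} [TopologicalSpace Y] [PreconnectedSpace Y]
    [MeasurableSpace Y] [OpensMeasurableSpace Y] [Nonempty Y] {γ : Measure Y}
    {T : Y → GaugeConfig d L Circle} (hT : Continuous T) (x₀ : Site d L) {μ ν : Fin d}
    (hD : ∀ y, T y ∉ collar μ ν 0) {m : Measure (GaugeConfig d L Circle)} {ε : ℝ}
    (hacc : ∀ S : Set (GaugeConfig d L Circle), MeasurableSet S →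
      |m.real S - (γ.map T).real S| ≤ ε) :
    ∃ q : ℤ, γ.map T {U | topCharge x₀ μ ν U ≠ q} = 0 ∧ m.real {U | topCharge x₀ μ ν U ≠ q} ≤ ε := by
  obtain ⟨y₀⟩ := ‹Nonempty Y›
  obtain ⟨q, hq⟩ := exists_int_eq_topCharge x₀ μ ν (T y₀)
  refine ⟨q, ?_, ?_⟩
  · rw [← hq]; exact map_topCharge_ne_eq_zero γ hT x₀ hD y₀
  · rw [← hq]; exact sectorMass_le_of_accurate hT x₀ hD hacc y₀

end Summit.Ventures.LatticeQCDFlow.Theory2.Lattice.Flux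

end
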